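import Literature.Topology.FourManifolds.ThetaFourKervaireMilnorFramedStep
import Literature.Topology.FourManifolds.SphereSurgeryOrientation
import Literature.Topology.FourManifolds.BordismOrientedMerging
import Literature.Topology.FourManifolds.IntersectionLatticeOrientationIffProofs
import Literature.Topology.FourManifolds.NormalFramingOfCircleGeneral
import Literature.Topology.FourManifolds.CobordismComposition
import Literature.Topology.FourManifolds.BallRemovalCobordism
import Literature.AlgebraicTopology.SingularHomology.ClopenAdditivity
import Literature.AlgebraicTopology.FundamentalGroupoid.SimplyConnectedComplPoint
import Literature.AlgebraicTopology.Homotopy.BallComplementRetract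
import HarnessLib

/-!
# Killing the fundamental group of an oriented 5-dimensional bordism by surgery on framed circles
# (Milnor 1961, Thm. 3, as used by Wall 1964, p. 142, and Kirby 1989, p. 55)

Topic `Literature/Topology/FourManifolds`.  Prove-seat of Wall's theorem
`Literature.Topology.FourManifolds.isHCobordant_of_equivalent_intersectionForm` (C. T. C. Wall,
*On simply-connected 4-manifolds*, J. London Math. Soc. 39 (1964), Thm. 2), step C5 of the
printed proof (p. 142): *"We know that `M⁴` bounds an orientable manifold `V⁵` … Then (Milnor
[5], Theorem 3) we can perform a series of spherical modifications to make `V⁵`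
simply-connected"*; Kirby (LNM 1374 (1989), Ch. X p. 55) performs the same step by trading the
1-handles of the bordism for 3-handles (*"This changes `W⁵` by a surgery on the `S¹` determined
by the 1-handle"*).  Milnor [5] = J. Milnor, *A procedure for killing homotopy groups of
differentiable manifolds*, Proc. Sympos. Pure Math. III (1961), Thm. 3 with Lemma 3.

Everything here is ASSEMBLED from theorems of the tree, in the currency of its null-cobordisms
(`NullCobordism`, surgery `NullCobordism.surgery` along framed sphere families):

* `NullCobordism.exists_framedCircle_homotopic_of_isRelFundamentalClass` — **in a connected
  compact oriented 5-manifold with boundary every loop is homotopic to the core of a framed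
  circle `S¹ × ℝ⁴ ↪ W`** whose surgery is again oriented: push the loop into the interior
  (collar, `NullCobordism.exists_homotopic_val_comp`), replace it by an embedded circle
  (Whitney, `2 · 1 < 5`, `HomotopySphere.exists_injective_immersion_homotopic_interior_five`),
  frame its normal bundle — the interior is `ℤ`-oriented by the relative fundamental class
  (`NullCobordism.interiorOrientation`), hence smoothly oriented
  (`isOrientable_of_isOrientableOver_int`), so the circle has a normal framing
  (`exists_normalFraming_of_smoothOrientation`, Hirsch 4.4 Ex. 2 in dimension 5) —, thicken it
  to a tube pushed into `W` (`exists_framedSphereFamily_halfSpace_of_isSmoothAlong`), and note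
  that the surgered manifold inherits a relative fundamental class
  (`NullCobordism.exists_isRelFundamentalClass_surgery`, `k = 1`, `l = 3`);
* `NullCobordism.exists_simplyConnectedSpace_of_isRelFundamentalClass` — **Milnor's Thm. 3 in
  dimension 5, one boundary block**: a connected compact 5-manifold `W` with `∂W = P` carrying a
  relative fundamental class may be replaced by a SIMPLY CONNECTED one with the same boundary
  (the `π₁`-bookkeeping is the tree's `NullCobordism.exists_simplyConnectedSpace_of_circleSurgery`,
  Kervaire–Milnor Thm. 5.5 / Milnor's Lemma 3).

No definition of a new notion, no named fact (D-0026).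

## References

* J. Milnor, *A procedure for killing homotopy groups of differentiable manifolds*, Proc.
  Sympos. Pure Math. III (AMS, 1961), 39–55, Thm. 3, Lemma 3. [MilnorKilling1961]
* C. T. C. Wall, *On simply-connected 4-manifolds*, J. London Math. Soc. 39 (1964), proof of
  Thm. 1, p. 142. [WallJLMS1964]
* R. C. Kirby, *The topology of 4-manifolds*, LNM 1374 (1989), Ch. X, p. 55. [Kirby1989]
* M. Kervaire, J. Milnor, *Groups of homotopy spheres I*, Ann. of Math. 77 (1963), Thm. 5.5,
  Lemma 5.3 (p. 513–514). [KervaireMilnorAnnals1963]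
-/

noncomputable section

open scoped Manifold ContDiff Topology
open Set Function
open Literature.AlgebraicTopology.SingularHomology

namespace Literature.Topology.FourManifolds

/-- Local notation: `𝔼 n` is the model Euclidean space `EuclideanSpace ℝ (Fin n)`. -/
local notation "𝔼 " n:arg => EuclideanSpace ℝ (Fin n)

/-- Local notation: `𝕊 n` is the unit sphere in `EuclideanSpace ℝ (Fin (n + 1))`. -/
local notation "𝕊 " n:arg => (Metric.sphere (0 : EuclideanSpace ℝ (Fin (n + 1))) 1)

namespace NullCobordism

variable {P : Type} [TopologicalSpace P] [ChartedSpace (𝔼 4) P]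
  [IsManifold (𝓡 4) ∞ P] [CompactSpace P]

/-- The property preserved by the surgeries: `(W, ∂W)` carries a relative fundamental class
over `ℤ` (an orientation of the compact 5-manifold with boundary, homologically). [folklore] -/
abbrev HasRelFundamentalClass (c : NullCobordism 4 P) : Prop :=
  ∃ w : relativeSingularHomology ℤ ℤ c.W ((𝓡∂ (4 + 1)).boundary c.W) (4 + 1),
    IsRelFundamentalClass ℤ ((𝓡∂ (4 + 1)).boundary c.W) w

attribute [local instance] fact_finrank_euclideanSpace_succ in
/-- **Every loop in a connected compact oriented 5-manifold with boundary is homotopic to the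
core of a framed circle whose surgery is again oriented** (Kervaire–Milnor Lemma 5.3 at `p = 1`
with the framing coming from orientability instead of s-parallelisability; Milnor 1961, proof of
Thm. 3; Kirby 1989 p. 55). [cite: MilnorKilling1961, Thm. 3 (proof)] [cite: KervaireMilnorAnnals1963, Lemma 5.3 (p. 513)] -/
theorem exists_framedCircle_homotopic_of_isRelFundamentalClass [Nonempty P]
    (c : NullCobordism 4 P) [ConnectedSpace c.W] (hc : c.HasRelFundamentalClass)
    (f : C(𝕊 1, c.W)) :
    ∃ ν : FramedSphereFamily (𝓡∂ (4 + 1)) c.W Unit 1 (3 + 1),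
      ν.sphereMap.Homotopic f ∧ (c.surgery ν rfl).HasRelFundamentalClass := by
  obtain ⟨w, hw⟩ := hc
  -- push the loop into the interior
  obtain ⟨g, hfg⟩ := c.exists_homotopic_val_comp f
  -- an embedded circle in its homotopy class (Whitney, `2 · 1 < 5`)
  obtain ⟨e, he, himm, hinj, hec, heg⟩ :=
    HomotopySphere.exists_injective_immersion_homotopic_interior_five (k := 1) (by norm_num) c g
  -- the interior is oriented
  have hor : IsOrientable (𝓡 (4 + 1)) (InteriorManifold (𝓡∂ (4 + 1)) c.W) :=
    isOrientable_of_isOrientableOver_int _ ⟨c.interiorOrientation hw⟩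
  obtain ⟨o⟩ := hor
  -- a normal framing of the circle and the framed tube, pushed into `W`
  obtain ⟨N, hN, hbij⟩ := exists_normalFraming_of_smoothOrientation (m := 4) o he himm
  obtain ⟨ν, hν⟩ := exists_framedSphereFamily_halfSpace_of_isSmoothAlong he hinj hN hbij
  refine ⟨ν, ?_, ?_⟩
  · have h1 : ν.sphereMap =
        (⟨InteriorManifold.val, InteriorManifold.continuous_val⟩ : C(_, c.W)).comp ⟨e, hec⟩ := by
      ext u
      exact hν u
    rw [h1]
    exact ((ContinuousMap.Homotopic.refl _).comp heg).trans hfg.symm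
  · exact c.exists_isRelFundamentalClass_surgery ν rfl le_rfl (by norm_num) hw

/-- **Milnor 1961, Thm. 3, in dimension 5 (one boundary block): a connected compact oriented
5-manifold with boundary `P` may be replaced by a simply connected one with the same boundary,
again oriented** — kill `π₁(W)` (finitely generated) by surgeries on framed circles in the
interior (`exists_framedCircle_homotopic_of_isRelFundamentalClass`), with the `π₁`-bookkeeping of
Kervaire–Milnor's Thm. 5.5 (`exists_simplyConnectedSpace_of_circleSurgery`). This is Wall's
*"we can perform a series of spherical modifications to make `V⁵` simply-connected"* (1964,
p. 142) and Kirby's trading of 1-handles (1989, p. 55).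
[cite: MilnorKilling1961, Thm. 3] [cite: WallJLMS1964, proof of Thm. 1, p. 142] [cite: Kirby1989, Ch. X, p. 55] -/
theorem exists_simplyConnectedSpace_of_hasRelFundamentalClass [Nonempty P]
    (c : NullCobordism 4 P) [ConnectedSpace c.W] (hc : c.HasRelFundamentalClass) :
    ∃ c₁ : NullCobordism 4 P, SimplyConnectedSpace c₁.W ∧ c₁.HasRelFundamentalClass := by
  refine exists_simplyConnectedSpace_of_circleSurgery (n := 4) (by norm_num)
    (fun c => c.HasRelFundamentalClass) (fun c hconn hQ f => ?_) c hc
  haveI := hconn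
  obtain ⟨ν, hν, hQ'⟩ := c.exists_framedCircle_homotopic_of_isRelFundamentalClass hQ f
  exact ⟨3, rfl, ν, hν, hQ'⟩

end NullCobordism

/-! ### Thom's dictionary with a fixed total space: `∂W = M ⊔ N` -/

section Dictionary

variable {n : ℕ} {M N : Type} [TopologicalSpace M] [ChartedSpace (𝔼 n) M]
  [TopologicalSpace N] [ChartedSpace (𝔼 n) N]

/-- **A cobordism from `M` to `N` is a null-cobordism of `M ⊔ N` with the same total space**
(Thom 1954, Ch. IV §1; Milnor 1965, §1: `∂W = M ⊔ N`). [cite: MilnorHCobordism1965, §1] -/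
def Cobordism.toNullCobordismSum [CompactSpace M] [CompactSpace N] (c : Cobordism n M N) :
    NullCobordism n (M ⊕ N) where
  W := c.W
  incl := Sum.elim c.inl c.inr
  isSmoothEmbedding_incl := c.isSmoothEmbedding_inl.sumElim c.isSmoothEmbedding_inr c.disjoint_range
  range_incl := by rw [Set.Sum.elim_range, c.range_inl_union_range_inr]

/-- The total space is unchanged (definitional). [folklore] -/
theorem Cobordism.toNullCobordismSum_W [CompactSpace M] [CompactSpace N] (c : Cobordism n M N) :
    c.toNullCobordismSum.W = c.W := rfl

variable [IsManifold (𝓡 n) ∞ M] [IsManifold (𝓡 n) ∞ N]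

/-- **A null-cobordism of `M ⊔ N` is a cobordism from `M` to `N` with the same total space**
(the construction inside `IsCobordant.of_sum_of_isEmpty`, Thom 1954 Ch. IV §1).
[cite: MilnorHCobordism1965, §1] -/
def NullCobordism.toCobordismOfSum (d : NullCobordism n (M ⊕ N)) : Cobordism n M N where
  W := d.W
  inl := d.incl ∘ Sum.inl
  inr := d.incl ∘ Sum.inr
  isSmoothEmbedding_inl := isSmoothEmbedding_comp_inl d.isSmoothEmbedding_incl
  isSmoothEmbedding_inr := isSmoothEmbedding_comp_inr d.isSmoothEmbedding_incl
  disjoint_range := by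
    refine Set.disjoint_left.2 ?_
    rintro _ ⟨x, rfl⟩ ⟨y, hy⟩
    exact Sum.inr_ne_inl (d.isSmoothEmbedding_incl.isEmbedding.injective hy)
  range_inl_union_range_inr := by
    rw [← d.range_incl]
    ext w
    constructor
    · rintro (⟨x, rfl⟩ | ⟨y, rfl⟩)
      · exact ⟨Sum.inl x, rfl⟩
      · exact ⟨Sum.inr y, rfl⟩
    · rintro ⟨x | y, rfl⟩
      · exact Or.inl ⟨x, rfl⟩
      · exact Or.inr ⟨y, rfl⟩

/-- The total space is unchanged (definitional). [folklore] -/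
theorem NullCobordism.toCobordismOfSum_W (d : NullCobordism n (M ⊕ N)) : d.toCobordismOfSum.W = d.W := rfl

end Dictionary

/-! ### Clopen pieces of a cobordism -/

section Clopen

variable {n : ℕ} {M N : Type} [TopologicalSpace M] [ChartedSpace (𝔼 n) M]
  [TopologicalSpace N] [ChartedSpace (𝔼 n) N] [IsManifold (𝓡 n) ∞ M] [IsManifold (𝓡 n) ∞ N]

/-- The empty open submanifold `⊥` of `N` is an empty type. [folklore] -/
instance isEmpty_botOpens : IsEmpty (⊥ : TopologicalSpace.Opens N) :=
  ⟨fun y => by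
    have h : (y : N) ∈ ((⊥ : TopologicalSpace.Opens N) : Set N) := y.2
    rw [TopologicalSpace.Opens.coe_bot] at h
    exact h⟩

namespace Cobordism

/-- **The restriction of a cobordism to an open-closed subset containing both ends** (a union of
components of `W` containing `M` and `N`) is again a cobordism from `M` to `N`. [folklore] -/
abbrev restrictClopen (c : Cobordism n M N) (U : TopologicalSpace.Opens c.W)
    (hUcl : IsClosed (U : Set c.W)) (hl : ∀ x, c.inl x ∈ U) (hr : ∀ y, c.inr y ∈ U) :
    Cobordism n M N :=
  haveI : CompactSpace U := isCompact_iff_compactSpace.1 hUcl.isCompact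
  { W := U
    inl := fun x => ⟨c.inl x, hl x⟩
    inr := fun y => ⟨c.inr y, hr y⟩
    isSmoothEmbedding_inl := c.isSmoothEmbedding_inl.codRestrict_opens U hl
    isSmoothEmbedding_inr := c.isSmoothEmbedding_inr.codRestrict_opens U hr
    disjoint_range := by
      refine Set.disjoint_left.2 ?_
      rintro _ ⟨x, rfl⟩ ⟨y, hy⟩
      exact Set.disjoint_left.1 c.disjoint_range (mem_range_self x) ⟨y, congrArg Subtype.val hy⟩
    range_inl_union_range_inr := by
      ext a
      rw [ModelWithCorners.boundary_open, mem_preimage, ← c.range_inl_union_range_inr]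
      constructor
      · rintro (⟨x, rfl⟩ | ⟨y, rfl⟩)
        · exact Or.inl ⟨x, rfl⟩
        · exact Or.inr ⟨y, rfl⟩
      · rintro (⟨x, hx⟩ | ⟨y, hy⟩)
        · exact Or.inl ⟨x, Subtype.ext hx⟩
        · exact Or.inr ⟨y, Subtype.ext hy⟩ }

/-- The total space of the restriction is the open-closed subset (definitional). [folklore] -/
theorem restrictClopen_W (c : Cobordism n M N) (U : TopologicalSpace.Opens c.W)
    (hUcl : IsClosed (U : Set c.W)) (hl : ∀ x, c.inl x ∈ U) (hr : ∀ y, c.inr y ∈ U) :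
    (c.restrictClopen U hUcl hl hr).W = U := rfl

/-- **The piece of a cobordism over an open-closed subset containing `M` and missing `N`** is a
cobordism from `M` to the empty manifold (realised as the empty open submanifold `⊥` of `N`).
[folklore] -/
abbrev pieceInl (c : Cobordism n M N) (U : TopologicalSpace.Opens c.W)
    (hUcl : IsClosed (U : Set c.W)) (hl : ∀ x, c.inl x ∈ U) (hr : ∀ y, c.inr y ∉ U) :
    Cobordism n M (⊥ : TopologicalSpace.Opens N) :=
  haveI : CompactSpace U := isCompact_iff_compactSpace.1 hUcl.isCompact
  { W := U
    inl := fun x => ⟨c.inl x, hl x⟩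
    inr := fun y => isEmptyElim y
    isSmoothEmbedding_inl := c.isSmoothEmbedding_inl.codRestrict_opens U hl
    isSmoothEmbedding_inr := isSmoothEmbedding_of_isEmpty _
    disjoint_range := by
      rw [Set.range_eq_empty (fun y : (⊥ : TopologicalSpace.Opens N) => (isEmptyElim y : U))]
      exact Set.disjoint_empty _
    range_inl_union_range_inr := by
      rw [Set.range_eq_empty (fun y : (⊥ : TopologicalSpace.Opens N) => (isEmptyElim y : U)),
        Set.union_empty]
      ext a
      rw [ModelWithCorners.boundary_open, mem_preimage, ← c.range_inl_union_range_inr]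
      constructor
      · rintro ⟨x, rfl⟩
        exact Or.inl ⟨x, rfl⟩
      · rintro (⟨x, hx⟩ | ⟨y, hy⟩)
        · exact ⟨x, Subtype.ext hx⟩
        · exact absurd (hy ▸ a.2) (hr y) }

omit [IsManifold (𝓡 n) ∞ N] in
/-- The total space of the piece (definitional). [folklore] -/
theorem pieceInl_W (c : Cobordism n M N) (U : TopologicalSpace.Opens c.W)
    (hUcl : IsClosed (U : Set c.W)) (hl : ∀ x, c.inl x ∈ U) (hr : ∀ y, c.inr y ∉ U) :
    (c.pieceInl U hUcl hl hr).W = U := rfl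

end Cobordism

end Clopen

/-! ### Two-piece clopen additivity of singular homology -/

section TwoPieces

variable {Z : Type} [TopologicalSpace Z]

/-- The two-piece family `U, Uᶜ`. [folklore] -/
def twoPieces (U : Set Z) : Bool → Set Z := fun b => cond b U Uᶜ

/-- A clopen set and its complement form a clopen partition. [folklore] -/
theorem isClopenPartition_twoPieces {U : Set Z} (hU : IsClopen U) :
    IsClopenPartition (twoPieces U) where
  isOpen b := by
    cases b
    · exact hU.compl.isOpen
    · exact hU.isOpen
  disjoint j k hjk := by
    cases j <;> cases k
    · exact absurd rfl hjk
    · exact disjoint_compl_left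
    · exact disjoint_compl_right
    · exact absurd rfl hjk
  exists_mem z := by
    by_cases hz : z ∈ U
    · exact ⟨true, hz⟩
    · exact ⟨false, hz⟩

/-- **Push-forward from a clopen subset is injective on singular homology** (Hatcher 2002,
Prop. 2.6, two pieces). [cite: HatcherAT2002, Prop. 2.6] -/
theorem map_subsetIncl_injective_of_isClopen {U : Set Z} (hU : IsClopen U) (k : ℕ) :
    Injective (singularHomology.map ℤ ℤ (subsetIncl U) k) :=
  singularHomology.map_subsetIncl_injective_of_isClopenPartition
    (isClopenPartition_twoPieces hU) true k

/-- **Independence of a clopen subset and its complement in singular homology**: if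
`(incl_U)_* y + (incl_{Uᶜ})_* y' = 0` then `y = 0` (Hatcher 2002, Prop. 2.6, two pieces).
[cite: HatcherAT2002, Prop. 2.6] -/
theorem eq_zero_of_map_subsetIncl_add_eq_zero {U : Set Z} (hU : IsClopen U) (k : ℕ)
    (y : singularHomology ℤ ℤ U k) (y' : singularHomology ℤ ℤ (Uᶜ : Set Z) k)
    (h : singularHomology.map ℤ ℤ (subsetIncl U) k y +
      singularHomology.map ℤ ℤ (subsetIncl Uᶜ) k y' = 0) : y = 0 := by
  classical
  let x : ∀ b, singularHomology ℤ ℤ (twoPieces U b) k := fun b =>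
    match b with
    | true => y
    | false => y'
  have hx : ∑ b ∈ (Finset.univ : Finset Bool),
      singularHomology.map ℤ ℤ (subsetIncl (twoPieces U b)) k (x b) = 0 := by
    rw [Fintype.sum_bool]
    exact h
  exact singularHomology.eq_zero_of_sum_map_subsetIncl_eq_zero
    (isClopenPartition_twoPieces hU) k Finset.univ x hx true (Finset.mem_univ _)

end TwoPieces

/-! ### Relative classes on the clopen pieces -/

section PieceClasses

variable {n : ℕ} {M N : Type} [TopologicalSpace M] [ChartedSpace (𝔼 n) M]
  [TopologicalSpace N] [ChartedSpace (𝔼 n) N] [IsManifold (𝓡 n) ∞ M] [IsManifold (𝓡 n) ∞ N]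

namespace Cobordism

/-- **The relative class of an oriented bordism restricts to the clopen piece containing both
ends**: if `∂w = (inl)_*[M] − (inr)_*[N]` on `W` then some `w' ∈ Hₙ₊₁(U, ∂U)` on the open-closed
piece `U ⊇ M, N` has `∂w' = (inl)_*[M] − (inr)_*[N]` (exactness of the pair `(U, ∂U)` at
`Hₙ(∂U)`: the class `(inl)_*[M] − (inr)_*[N]` dies in `Hₙ(U)` because its image in `Hₙ(W)` is
`i_*(∂w) = 0` and `Hₙ(U) → Hₙ(W)` is injective for a clopen `U`, Hatcher 2002 Prop. 2.6 and
Thm. 2.16). [cite: HatcherAT2002, Prop. 2.6 and Thm. 2.16] -/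
theorem exists_δ_eq_restrictClopen (c : Cobordism n M N) (U : TopologicalSpace.Opens c.W)
    (hUcl : IsClosed (U : Set c.W)) (hl : ∀ x, c.inl x ∈ U) (hr : ∀ y, c.inr y ∈ U)
    (μ : HomologicalOrientation ℤ M n) (ν : HomologicalOrientation ℤ N n)
    {w : relativeSingularHomology ℤ ℤ c.W ((𝓡∂ (n + 1)).boundary c.W) (n + 1)}
    (hw : relativeSingularHomology.δ ℤ ℤ c.W ((𝓡∂ (n + 1)).boundary c.W) n w =
      singularHomology.map ℤ ℤ c.inlBoundary n μ.fundamentalClass -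
        singularHomology.map ℤ ℤ c.inrBoundary n ν.fundamentalClass) :
    ∃ w' : relativeSingularHomology ℤ ℤ (c.restrictClopen U hUcl hl hr).W
        ((𝓡∂ (n + 1)).boundary (c.restrictClopen U hUcl hl hr).W) (n + 1),
      relativeSingularHomology.δ ℤ ℤ _ ((𝓡∂ (n + 1)).boundary (c.restrictClopen U hUcl hl hr).W) n w' =
        singularHomology.map ℤ ℤ (c.restrictClopen U hUcl hl hr).inlBoundary n μ.fundamentalClass -
          singularHomology.map ℤ ℤ (c.restrictClopen U hUcl hl hr).inrBoundary n ν.fundamentalClass := by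
  -- boundary points of the piece are boundary points of `W`
  have hb : ∀ x : (c.restrictClopen U hUcl hl hr).W, x ∈ (𝓡∂ (n + 1)).boundary (c.restrictClopen U hUcl hl hr).W →
      ((x : ↥U) : c.W) ∈ (𝓡∂ (n + 1)).boundary c.W := fun x hx => by
    have hx' : (x : ↥U) ∈ (𝓡∂ (n + 1)).boundary ↥U := hx
    rwa [ModelWithCorners.boundary_open] at hx'
  -- the maps
  set iU : C(↥((𝓡∂ (n + 1)).boundary (c.restrictClopen U hUcl hl hr).W), (c.restrictClopen U hUcl hl hr).W) := subsetIncl _ with hiU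
  set iW : C(↥((𝓡∂ (n + 1)).boundary c.W), c.W) := subsetIncl _ with hiW
  set bU : C((c.restrictClopen U hUcl hl hr).W, c.W) :=
    ⟨fun x => ((x : ↥U) : c.W), continuous_subtype_val⟩ with hbU
  set aU : C(↥((𝓡∂ (n + 1)).boundary (c.restrictClopen U hUcl hl hr).W), ↥((𝓡∂ (n + 1)).boundary c.W)) :=
    ⟨fun x => ⟨((x.1 : ↥U) : c.W), hb x.1 x.2⟩,
      (continuous_subtype_val.comp continuous_subtype_val).subtype_mk _⟩ with haU
  have h1 : bU.comp iU = iW.comp aU := ContinuousMap.ext fun _ => rfl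
  have h2 : aU.comp (c.restrictClopen U hUcl hl hr).inlBoundary = c.inlBoundary :=
    ContinuousMap.ext fun _ => rfl
  have h3 : aU.comp (c.restrictClopen U hUcl hl hr).inrBoundary = c.inrBoundary :=
    ContinuousMap.ext fun _ => rfl
  -- the class to be lifted dies in `Hₙ(U)`
  set z : singularHomology ℤ ℤ (↥((𝓡∂ (n + 1)).boundary (c.restrictClopen U hUcl hl hr).W)) n :=
    singularHomology.map ℤ ℤ (c.restrictClopen U hUcl hl hr).inlBoundary n μ.fundamentalClass -
      singularHomology.map ℤ ℤ (c.restrictClopen U hUcl hl hr).inrBoundary n ν.fundamentalClass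
    with hz
  have hza : singularHomology.map ℤ ℤ aU n z =
      relativeSingularHomology.δ ℤ ℤ c.W ((𝓡∂ (n + 1)).boundary c.W) n w := by
    rw [hw, hz, map_sub, ← ModuleCat.comp_apply, ← singularHomology.map_comp, h2,
      ← ModuleCat.comp_apply, ← singularHomology.map_comp, h3]
  have hzero : singularHomology.map ℤ ℤ bU n (singularHomology.map ℤ ℤ iU n z) = 0 := by
    rw [← ModuleCat.comp_apply, ← singularHomology.map_comp, h1, singularHomology.map_comp,
      ModuleCat.comp_apply, hza, ← ModuleCat.comp_apply, hiW,
      relativeSingularHomology.δ_comp_map]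
    rfl
  have hUclopen : IsClopen (U : Set c.W) := ⟨hUcl, U.isOpen⟩
  have hinj := map_subsetIncl_injective_of_isClopen hUclopen n
  have hker : singularHomology.map ℤ ℤ iU n z = 0 :=
    hinj (by rw [map_zero]; exact hzero)
  -- exactness of `Hₙ₊₁(U, ∂U) → Hₙ(∂U) → Hₙ(U)`
  obtain ⟨w', hw'⟩ := (CategoryTheory.ShortComplex.moduleCat_exact_iff _).1
    (relativeSingularHomology.exact_δ_map ℤ ℤ ((𝓡∂ (n + 1)).boundary (c.restrictClopen U hUcl hl hr).W) n) _ hker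
  exact ⟨w', hw'⟩

omit [IsManifold (𝓡 n) ∞ N] in
/-- **The relative class of an oriented bordism restricts to a clopen piece containing `M` and
missing `N`**: some `w' ∈ Hₙ₊₁(U, ∂U)` has `∂w' = (inl)_*[M]` — in the form required by
`Cobordism.isRelFundamentalClass_of_δ_eq` for the piece read as a cobordism to the empty
manifold. The class `(inl)_*[M]` dies in `Hₙ(U)`: its image in `Hₙ(W)` is
`i_*(∂w) + (inr)_*[N]`, the first term vanishes and the second comes from the complementary
clopen piece, so independence of the pieces (Hatcher 2002, Prop. 2.6) applies.
[cite: HatcherAT2002, Prop. 2.6 and Thm. 2.16] -/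
theorem exists_δ_eq_pieceInl (c : Cobordism n M N) (U : TopologicalSpace.Opens c.W)
    (hUcl : IsClosed (U : Set c.W)) (hl : ∀ x, c.inl x ∈ U) (hr : ∀ y, c.inr y ∉ U)
    (μ : HomologicalOrientation ℤ M n) (ν : HomologicalOrientation ℤ N n)
    (ν₀ : HomologicalOrientation ℤ (⊥ : TopologicalSpace.Opens N) n)
    {w : relativeSingularHomology ℤ ℤ c.W ((𝓡∂ (n + 1)).boundary c.W) (n + 1)}
    (hw : relativeSingularHomology.δ ℤ ℤ c.W ((𝓡∂ (n + 1)).boundary c.W) n w =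
      singularHomology.map ℤ ℤ c.inlBoundary n μ.fundamentalClass -
        singularHomology.map ℤ ℤ c.inrBoundary n ν.fundamentalClass) :
    ∃ w' : relativeSingularHomology ℤ ℤ (c.pieceInl U hUcl hl hr).W
        ((𝓡∂ (n + 1)).boundary (c.pieceInl U hUcl hl hr).W) (n + 1),
      relativeSingularHomology.δ ℤ ℤ _ ((𝓡∂ (n + 1)).boundary (c.pieceInl U hUcl hl hr).W) n w' =
        singularHomology.map ℤ ℤ (c.pieceInl U hUcl hl hr).inlBoundary n μ.fundamentalClass -
          singularHomology.map ℤ ℤ (c.pieceInl U hUcl hl hr).inrBoundary n ν₀.fundamentalClass := by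
  have hb : ∀ x : (c.pieceInl U hUcl hl hr).W, x ∈ (𝓡∂ (n + 1)).boundary (c.pieceInl U hUcl hl hr).W →
      ((x : ↥U) : c.W) ∈ (𝓡∂ (n + 1)).boundary c.W := fun x hx => by
    have hx' : (x : ↥U) ∈ (𝓡∂ (n + 1)).boundary ↥U := hx
    rwa [ModelWithCorners.boundary_open] at hx'
  -- the maps
  set iU : C(↥((𝓡∂ (n + 1)).boundary (c.pieceInl U hUcl hl hr).W), (c.pieceInl U hUcl hl hr).W) := subsetIncl _ with hiU
  set iW : C(↥((𝓡∂ (n + 1)).boundary c.W), c.W) := subsetIncl _ with hiW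
  set aU : C(↥((𝓡∂ (n + 1)).boundary (c.pieceInl U hUcl hl hr).W), ↥((𝓡∂ (n + 1)).boundary c.W)) :=
    ⟨fun x => ⟨((x.1 : ↥U) : c.W), hb x.1 x.2⟩,
      (continuous_subtype_val.comp continuous_subtype_val).subtype_mk _⟩ with haU
  set bU : C((c.pieceInl U hUcl hl hr).W, c.W) :=
    ⟨fun x => ((x : ↥U) : c.W), continuous_subtype_val⟩ with hbU
  have h1 : bU.comp iU = iW.comp aU := ContinuousMap.ext fun _ => rfl
  have h2 : aU.comp (c.pieceInl U hUcl hl hr).inlBoundary = c.inlBoundary :=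
    ContinuousMap.ext fun _ => rfl
  -- `inr N` lands in the complementary piece
  have hrc : ∀ y, c.inr y ∈ ((U : Set c.W)ᶜ : Set c.W) := fun y => hr y
  set jN : C(N, ↥((U : Set c.W)ᶜ : Set c.W)) := ⟨fun y => ⟨c.inr y, hrc y⟩,
    c.continuous_inr.subtype_mk _⟩ with hjN
  have h4 : (subsetIncl ((U : Set c.W)ᶜ)).comp jN = iW.comp c.inrBoundary :=
    ContinuousMap.ext fun _ => rfl
  -- the class to be lifted and its image in `Hₙ(W)`
  have hν₀ : ν₀.fundamentalClass = 0 := ν₀.fundamentalClass_eq_zero_of_isEmpty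
  set z : singularHomology ℤ ℤ (↥((𝓡∂ (n + 1)).boundary (c.pieceInl U hUcl hl hr).W)) n :=
    singularHomology.map ℤ ℤ (c.pieceInl U hUcl hl hr).inlBoundary n μ.fundamentalClass -
      singularHomology.map ℤ ℤ (c.pieceInl U hUcl hl hr).inrBoundary n ν₀.fundamentalClass with hz
  have hz' : z = singularHomology.map ℤ ℤ (c.pieceInl U hUcl hl hr).inlBoundary n μ.fundamentalClass := by
    rw [hz, hν₀, map_zero, sub_zero]
  have hza : singularHomology.map ℤ ℤ aU n z =
      relativeSingularHomology.δ ℤ ℤ c.W ((𝓡∂ (n + 1)).boundary c.W) n w +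
        singularHomology.map ℤ ℤ c.inrBoundary n ν.fundamentalClass := by
    rw [hw, hz', ← ModuleCat.comp_apply, ← singularHomology.map_comp, h2, sub_add_cancel]
  have hsum : singularHomology.map ℤ ℤ bU n
        (singularHomology.map ℤ ℤ iU n z) +
      singularHomology.map ℤ ℤ (subsetIncl ((U : Set c.W)ᶜ)) n
        (singularHomology.map ℤ ℤ jN n (-ν.fundamentalClass)) = 0 := by
    have e1 : singularHomology.map ℤ ℤ bU n
        (singularHomology.map ℤ ℤ iU n z) =
        singularHomology.map ℤ ℤ iW n
          (singularHomology.map ℤ ℤ c.inrBoundary n ν.fundamentalClass) := by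
      rw [← ModuleCat.comp_apply, ← singularHomology.map_comp, h1, singularHomology.map_comp,
        ModuleCat.comp_apply, hza, map_add, ← ModuleCat.comp_apply (relativeSingularHomology.δ _ _ _ _ _),
        hiW, relativeSingularHomology.δ_comp_map]
      simp
    have e2 : singularHomology.map ℤ ℤ (subsetIncl ((U : Set c.W)ᶜ)) n
        (singularHomology.map ℤ ℤ jN n (-ν.fundamentalClass)) =
        - singularHomology.map ℤ ℤ iW n
          (singularHomology.map ℤ ℤ c.inrBoundary n ν.fundamentalClass) := by
      rw [map_neg, map_neg, ← ModuleCat.comp_apply, ← singularHomology.map_comp, h4,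
        singularHomology.map_comp, ModuleCat.comp_apply]
    rw [e1, e2, add_neg_cancel]
  have hUclopen : IsClopen (U : Set c.W) := ⟨hUcl, U.isOpen⟩
  have hker : singularHomology.map ℤ ℤ iU n z = 0 :=
    eq_zero_of_map_subsetIncl_add_eq_zero hUclopen n _ _ hsum
  obtain ⟨w', hw'⟩ := (CategoryTheory.ShortComplex.moduleCat_exact_iff _).1
    (relativeSingularHomology.exact_δ_map ℤ ℤ ((𝓡∂ (n + 1)).boundary (c.pieceInl U hUcl hl hr).W) n) _ hker
  exact ⟨w', hw'⟩

end Cobordism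

end PieceClasses

/-! ### Punctured simply connected null-cobordisms -/

section Punctured

variable {P : Type} [TopologicalSpace P] [ChartedSpace (𝔼 4) P] [IsManifold (𝓡 4) ∞ P]

/-- **Removing an open ball from a simply connected compact 5-manifold with boundary leaves it
simply connected** (van Kampen across the punctured ball, `dim = 5 ≥ 3`: the tree's
`isSimplyConnected_compl_singleton_of_isOpenEmbedding` and `BallComplement.homotopyEquiv`,
transported along `BallRemovalData.homeomorph`; Milnor 1965 §9, proof of Prop. B).
[cite: MilnorHCobordism1965, §9, proof of Prop. B] -/
theorem NullCobordism.simplyConnectedSpace_ballRemoval_cobordism (d : NullCobordism 4 P)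
    [SimplyConnectedSpace d.W] (D : BallRemovalData 4 d.W) :
    SimplyConnectedSpace (D.cobordism d).W := by
  haveI : SimplyConnectedSpace (D.Compl d) := by
    haveI := (Literature.AlgebraicTopology.FundamentalGroupoid.isSimplyConnected_compl_singleton_of_isOpenEmbedding
      D.isOpenEmbedding_i (by simp)).simplyConnectedSpace
    exact (Literature.AlgebraicTopology.Homotopy.BallComplement.homotopyEquiv
      D.isOpenEmbedding_i).simplyConnectedSpace
  exact (D.homeomorph d).toHomotopyEquiv.simplyConnectedSpace

end Punctured

/-! ### Milnor's Thm. 3 for the bordism between two simply connected 4-manifolds -/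

section Main

variable {M N : Type} [TopologicalSpace M] [T2Space M] [SecondCountableTopology M]
  [ChartedSpace (𝔼 4) M] [CompactSpace M] [IsManifold (𝓡 4) ∞ M]
  [TopologicalSpace N] [T2Space N]
  [ChartedSpace (𝔼 4) N] [CompactSpace N] [IsManifold (𝓡 4) ∞ N]

omit [SecondCountableTopology M] in
/-- **The piece of an oriented bordism over the component of `M`.**  Given a cobordism `W` from
the connected `M` to the connected `N` with a relative class `w`, `∂w = (inl)_*[M] − (inr)_*[N]`,
the component `C` of `W` containing `M` is open-closed; either it contains `N`, and then
`(C; M, N)` is a CONNECTED cobordism carrying a relative fundamental class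
(`exists_δ_eq_restrictClopen`, `Cobordism.isRelFundamentalClass_of_δ_eq`), or it misses `N`,
and then `C` is a connected oriented null-cobordism of `M` (`exists_δ_eq_pieceInl`).
[cite: MilnorStasheff1974, §17 p. 200] [cite: HatcherAT2002, Prop. 2.6] -/
theorem Cobordism.exists_connected_piece_of_δ_eq [ConnectedSpace M] [ConnectedSpace N]
    (c : Cobordism 4 M N) (μ : HomologicalOrientation ℤ M 4) (ν : HomologicalOrientation ℤ N 4)
    {w : relativeSingularHomology ℤ ℤ c.W ((𝓡∂ (4 + 1)).boundary c.W) (4 + 1)}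
    (hw : relativeSingularHomology.δ ℤ ℤ c.W ((𝓡∂ (4 + 1)).boundary c.W) 4 w =
      singularHomology.map ℤ ℤ c.inlBoundary 4 μ.fundamentalClass -
        singularHomology.map ℤ ℤ c.inrBoundary 4 ν.fundamentalClass) :
    (∃ c₁ : Cobordism 4 M N, ConnectedSpace c₁.W ∧
        ∃ w₁ : relativeSingularHomology ℤ ℤ c₁.W ((𝓡∂ (4 + 1)).boundary c₁.W) (4 + 1),
          IsRelFundamentalClass ℤ ((𝓡∂ (4 + 1)).boundary c₁.W) w₁) ∨
      (∃ d : NullCobordism 4 M, ConnectedSpace d.W ∧ d.HasRelFundamentalClass) := by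
  classical
  obtain ⟨m₀⟩ := (inferInstance : Nonempty M)
  haveI := ChartedSpace.locallyPathConnectedSpace (EuclideanHalfSpace (4 + 1)) c.W
  set C : Set c.W := connectedComponent (c.inl m₀) with hC
  have hCo : IsOpen C := isOpen_connectedComponent
  have hCcl : IsClosed C := isClosed_connectedComponent
  let U : TopologicalSpace.Opens c.W := ⟨C, hCo⟩
  have hUC : (U : Set c.W) = C := rfl
  haveI : ConnectedSpace U := isConnected_iff_connectedSpace.1 isConnected_connectedComponent
  -- `inl M ⊆ C`
  have hl : ∀ x, c.inl x ∈ U := fun x =>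
    (isPreconnected_range c.continuous_inl).subset_connectedComponent (mem_range_self m₀)
      (mem_range_self x)
  by_cases hN : ∃ y, c.inr y ∈ U
  · -- the component contains `N`: a connected oriented cobordism from `M` to `N`
    obtain ⟨y₀, hy₀⟩ := hN
    have hr : ∀ y, c.inr y ∈ U := fun y => by
      have h1 : range c.inr ⊆ connectedComponent (c.inr y₀) :=
        (isPreconnected_range c.continuous_inr).subset_connectedComponent (mem_range_self y₀)
      have h2 : connectedComponent (c.inr y₀) = C := (connectedComponent_eq hy₀).symm
      show c.inr y ∈ C
      rw [← h2]
      exact h1 (mem_range_self y)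
    refine Or.inl ⟨c.restrictClopen U hCcl hl hr, ‹ConnectedSpace U›, ?_⟩
    obtain ⟨w₁, hw₁⟩ := c.exists_δ_eq_restrictClopen U hCcl hl hr μ ν hw
    haveI : ConnectedSpace (c.restrictClopen U hCcl hl hr).W := ‹ConnectedSpace U›
    exact ⟨w₁, (c.restrictClopen U hCcl hl hr).isRelFundamentalClass_of_δ_eq μ ν hw₁⟩
  · -- the component misses `N`: a connected oriented null-cobordism of `M`
    push Not at hN
    let ν₀ : HomologicalOrientation ℤ (⊥ : TopologicalSpace.Opens N) 4 := ν.restrictOpens ⊥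
    obtain ⟨w₁, hw₁⟩ := c.exists_δ_eq_pieceInl U hCcl hl hN μ ν ν₀ hw
    haveI : ConnectedSpace (c.pieceInl U hCcl hl hN).W := ‹ConnectedSpace U›
    haveI : CompactSpace (⊥ : TopologicalSpace.Opens N) :=
      ⟨by rw [Set.univ_eq_empty_iff.2 inferInstance]; exact isCompact_empty⟩
    have hfc := (c.pieceInl U hCcl hl hN).isRelFundamentalClass_of_δ_eq μ ν₀ hw₁
    refine Or.inr ⟨NullCobordism.ofCobordism (c.pieceInl U hCcl hl hN), ‹ConnectedSpace U›, ?_⟩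
    exact ⟨w₁, hfc⟩

attribute [local instance] fact_finrank_euclideanSpace_succ in
/-- **Milnor 1961, Thm. 3, for the bordism between two simply connected closed 4-manifolds
(Wall 1964, p. 142; Kirby 1989, p. 55): an oriented bordism between simply connected closed
smooth 4-manifolds may be replaced by a SIMPLY CONNECTED cobordism.**  From a witness `(W, w)` of
`IsOrientedBordant 4 μ ν` take the component of `M` (`exists_connected_piece_of_δ_eq`).  If it
contains `N`, read it as a connected oriented null-cobordism of `M ⊔ N` (`toNullCobordismSum`),
kill its fundamental group by surgery on framed circles
(`NullCobordism.exists_simplyConnectedSpace_of_hasRelFundamentalClass`) and read the result back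
as a cobordism from `M` to `N` (`toCobordismOfSum`); likewise for a witness of the symmetric
relation.  Otherwise `M` and `N` bound connected oriented 5-manifolds separately; make both
simply connected, remove an open ball from each (`BallRemovalData.cobordism`, still simply
connected, `simplyConnectedSpace_ballRemoval_cobordism`) and compose `M → S⁴ → N`
(`Cobordism.exists_composite`, van Kampen).
[cite: MilnorKilling1961, Thm. 3] [cite: WallJLMS1964, proof of Thm. 1, p. 142] [cite: Kirby1989, Ch. X, proof of Thm. 1, p. 55] -/
theorem exists_cobordism_simplyConnectedSpace_of_isOrientedBordant
    [SimplyConnectedSpace M] [SimplyConnectedSpace N]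
    (μ : HomologicalOrientation ℤ M 4) (ν : HomologicalOrientation ℤ N 4)
    (h : IsOrientedBordant 4 μ ν) : ∃ c : Cobordism 4 M N, SimplyConnectedSpace c.W := by
  have h' := h.symm
  obtain ⟨c, w, hw⟩ := h
  obtain ⟨c', w', hw'⟩ := h'
  rcases c.exists_connected_piece_of_δ_eq μ ν hw with ⟨c₁, hconn, w₁, hw₁⟩ | ⟨dM, hdMc, hdM⟩
  · -- a connected oriented cobordism from `M` to `N`
    haveI : ConnectedSpace c₁.toNullCobordismSum.W := hconn
    obtain ⟨d₁, hsc, -⟩ :=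
      c₁.toNullCobordismSum.exists_simplyConnectedSpace_of_hasRelFundamentalClass ⟨w₁, hw₁⟩
    exact ⟨d₁.toCobordismOfSum, hsc⟩
  rcases c'.exists_connected_piece_of_δ_eq ν μ hw' with ⟨c₁, hconn, w₁, hw₁⟩ | ⟨dN, hdNc, hdN⟩
  · -- a connected oriented cobordism from `N` to `M`
    haveI : ConnectedSpace c₁.toNullCobordismSum.W := hconn
    obtain ⟨d₁, hsc, -⟩ :=
      c₁.toNullCobordismSum.exists_simplyConnectedSpace_of_hasRelFundamentalClass ⟨w₁, hw₁⟩
    exact ⟨d₁.toCobordismOfSum.symm, hsc⟩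
  -- `M` and `N` bound separately: puncture and compose through `S⁴`
  haveI := hdMc
  haveI := hdNc
  obtain ⟨eM, hscM, -⟩ := dM.exists_simplyConnectedSpace_of_hasRelFundamentalClass hdM
  obtain ⟨eN, hscN, -⟩ := dN.exists_simplyConnectedSpace_of_hasRelFundamentalClass hdN
  haveI := hscM
  haveI := hscN
  obtain ⟨DM⟩ := eM.nonempty_ballRemovalData
  obtain ⟨DN⟩ := eN.nonempty_ballRemovalData
  have h1 : SimplyConnectedSpace (DM.cobordism eM).W := eM.simplyConnectedSpace_ballRemoval_cobordism DM
  have h2 : SimplyConnectedSpace (DN.cobordism eN).symm.W := eN.simplyConnectedSpace_ballRemoval_cobordism DN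
  haveI : PathConnectedSpace (𝕊 4) :=
    isPathConnected_iff_pathConnectedSpace.1 (isPathConnected_sphere (by
      rw [← Module.finrank_eq_rank, finrank_euclideanSpace, Fintype.card_fin]
      norm_num) 0 zero_le_one)
  obtain ⟨cc, -, -, -, -, -, -, -, hsc, -⟩ :=
    Cobordism.exists_composite (DM.cobordism eM) (DN.cobordism eN).symm
  exact ⟨cc, hsc h1 h2 inferInstance⟩

end Main

end Literature.Topology.FourManifolds

end
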